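import Mathlib
import HarnessLib
import Summits.HubbardSuperconductivity.HubbardSuperconductivity.Theorems.KLProgrammeLatticeSoftBubbleSharpTC
import Summits.HubbardSuperconductivity.HubbardSuperconductivity.Theorems.KLProgrammeForwardBubbleSoftSharpTCQuasi

/-!
# Route `KLProgramme` — ENGINE stmt-HubbardSuperconductivity-20437 `KLRegimeEngineV17F2`, row (c) value lane / class-#5 STEP (X).3 pinned pair: the forward / SOFT slice bubble
# ON THE LATTICE with the sharp zero-sound term, split count, path transfer constant AND ANGLE-DEPENDENT QUASI-LIPSCHITZ RADIAL DATA (brick (L3)-3 of cure (A″) route 3′ of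
# located «(c)-OUT-COOPER-ANTIPODE»; cell gate-hubbard-kl, seat hubbard-kl-k3c2-p2 g26, technique «thermal-bar induction n ≤ nScales β + 1 with EngineBoundsAtV4S sums»)

WHY.  `klfl_lattice_forward_bubble_norm_le_of_lipschitzTC` / `klfl_lattice_soft_bubble_norm_leTC` (…LatticeSoftBubbleSharpTC, g22; the lattice layer of the member rows of
record) use the weight's GLOBAL Lipschitz constant `L_a` twice: in the lattice→continuum Riemann error `32Λₙ·K/L` (harmless: slot `¼Q.CL β n/L`) and as the UNIFORM radial
modulus of the zero-sound remainder (vacuous near the Cooper antipode at deep scales — COOPER-ANTIPODE.md).  As in brick L1 (`klfl_lattice_forward_bubble_norm_le_cells`, g25)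
the second use is replaced by PER-RAY, TUBE-LOCAL QUASI-Lipschitz data `‖a(t·dir θ) − a(t'·dir θ)‖ ≤ A₁(θ)|t − t'| + δ_A(θ)` (integrable angle profiles; what CELL lattice data
give through `klpe_ext_quasi_lipschitz_of_cell`), fed to `klfs_planar_bubble_norm_le_of_lipschitzTCQ`: the planar bracket becomes the θ-INTEGRAL of the per-ray bracket at
`(A₀, A₁(θ) + 2A₀/zm, δ_A(θ))`, with the scale-free defect `(128/π)·M_F·(π√2/d)·δ_A(θ)`.
* **`klfl_lattice_forward_bubble_norm_le_of_lipschitzTC_cells`**, **`klfl_lattice_soft_bubble_norm_leTC_cells`**.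
The g22 proofs verbatim with the radial step and the planar call replaced; nothing about the model is asserted; nothing asserts (X).3, (c), K3 or superconductivity.
References: BGM 2006 §2.4–2.5 [cite: BenfattoGiulianiMastropietro2006]; FST 1998 App. B [cite: FeldmanSalmhoferTrubowitz1998].  0 kit · 0 lit.
-/

noncomputable section

namespace Summit.HubbardSuperconductivity.HubbardSuperconductivity.Theorems.KLRegimeSplit

set_option linter.dupNamespace false -- summit = problem name (single-conjunct summit), D-0017

open Real Set Filter MeasureTheory Complex Literature.MathematicalPhysics.QuantumLattice Literature.Probability.LatticeModels
open Literature.MathematicalPhysics.QuantumLattice.BandSectorCounting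
open Summit.HubbardSuperconductivity.HubbardSuperconductivity.Theorems.PerturbedFermiCurve
open Summit.HubbardSuperconductivity.HubbardSuperconductivity.Theorems.KLProgrammeLegKernels
open scoped NNReal

/-! ## §1 The forward slice bubble on the model carrier, second line by its joint Lipschitz constant, per-ray quasi-Lipschitz weight data -/

section Lattice

variable {a' b' : ℝ} (B : BandBounds a' b') {δ : (Fin 2 → ℝ) → ℝ} (hδ1 : ContDiff ℝ 1 δ) {κ₀ κ₁ : ℝ}
  (hδ : ∀ k : Fin 2 → ℝ, (∀ i, |k i| ≤ π) → |δ k| ≤ κ₀)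
  (hκ : ∀ k : Fin 2 → ℝ, (∀ i, |k i| ≤ π) → ‖fderiv ℝ δ k‖ ≤ κ₁) (hκ₁ : κ₁ < B.Dtmin)

include B hδ1 hδ hκ hκ₁ in
/-- **THE FORWARD SLICE BUBBLE ON `MatsubaraIdx M × TorusSite 2 L`, second line by `(K′, M′)`, WITH ANGLE-DEPENDENT QUASI-LIPSCHITZ RADIAL DATA**:
`klfl_lattice_forward_bubble_norm_le_of_lipschitzTC` VERBATIM except that the weight's radial datum is asked PER RAY on the tube segment as
`‖a(t·dir θ) − a(t'·dir θ)‖ ≤ A₁(θ)|t − t'| + δ_A(θ)` and the planar bracket is the θ-integral of the per-ray bracket at `(A₀, A₁(θ) + 2A₀/zm, δ_A(θ))`; `L_a` serves only the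
Riemann error `32Λₙ·K/L`. -/
theorem klfl_lattice_forward_bubble_norm_le_of_lipschitzTC_cells
    {κ₂ : ℝ} (hκ₂ : 0 ≤ κ₂)
    (hD2 : ∀ θ s t : ℝ, s ∈ Icc 0 (π / ‖dir θ‖) → t ∈ Icc 0 (π / ‖dir θ‖) →
      |fderiv ℝ δ (s • dir θ) (dir θ) - fderiv ℝ δ (t • dir θ) (dir θ)| ≤ κ₂ * |s - t|)
    {a : ℝ × ℝ → ℂ} (ha : Continuous a) (ha1 : ∀ x y, a (x + 2 * π, y) = a (x, y)) (ha2 : ∀ x y, a (x, y + 2 * π) = a (x, y))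
    {A₀ La : ℝ} (hA0 : ∀ p, ‖a p‖ ≤ A₀) (hLa : ∀ p q, ‖a p - a q‖ ≤ La * dist p q)
    {eb : ℝ × ℝ → ℝ} (hebc : Continuous eb) (heb1 : ∀ x y, eb (x + 2 * π, y) = eb (x, y)) (heb2 : ∀ x y, eb (x, y + 2 * π) = eb (x, y))
    {Le : ℝ} (hLe : ∀ p q, |eb p - eb q| ≤ Le * dist p q) {μ : ℝ} (heb : ∀ p ∈ Icc (-π) π ×ˢ Icc (-π) π, eb p = klfb_band δ μ p)
    {eb' : ℝ × ℝ → ℝ} (heb'c : Continuous eb') (heb'1 : ∀ x y, eb' (x + 2 * π, y) = eb' (x, y)) (heb'2 : ∀ x y, eb' (x, y + 2 * π) = eb' (x, y))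
    {Le' : ℝ} (hLe' : ∀ p q, |eb' p - eb' q| ≤ Le' * dist p q) {δmax : ℝ} (hδ0 : 0 ≤ δmax)
    (he'δ : ∀ p : ℝ × ℝ, |p.1| < π → |p.2| < π → |eb' p - klfb_band δ μ p| ≤ δmax)
    {zm : ℝ} (hzm : 0 < zm) {n : ℕ}
    (hzone : ∀ p ∈ Icc (-π) π ×ˢ Icc (-π) π, |eb p| < 4 * klScale klE0 n → |p.1| ≤ π - 2 * zm ∧ |p.2| ≤ π - 2 * zm)
    {A₁ δA : ℝ → ℝ} (hA1' : ∀ θ, 0 ≤ A₁ θ) (hδA' : ∀ θ, 0 ≤ δA θ)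
    (hA1i : IntegrableOn A₁ (Ioo (-π) π)) (hδAi : IntegrableOn δA (Ioo (-π) π))
    (haq : ∀ θ t t' : ℝ, 0 ≤ t → 0 ≤ t' → |klfb_band δ μ (t * Real.cos θ, t * Real.sin θ)| < 4 * klScale klE0 n →
      |klfb_band δ μ (t' * Real.cos θ, t' * Real.sin θ)| < 4 * klScale klE0 n →
      ‖a (t * Real.cos θ, t * Real.sin θ) - a (t' * Real.cos θ, t' * Real.sin θ)‖ ≤ A₁ θ * |t - t'| + δA θ)
    {f f' : ℝ → ℂ} {Lf Mf ℓf LF MF ℓ : ℝ}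
    (hlip : ∀ s s', ‖f s - f s'‖ ≤ Lf * |s - s'|) (hbd : ∀ s, ‖f s‖ ≤ Mf) (hLf : Lf ≤ ℓf / klScale klE0 n ^ 2)
    (hin : ∀ s, s ≤ (klScale klE0 n / 2) ^ 2 → f s = 0) (hout : ∀ s, (4 * klScale klE0 n) ^ 2 ≤ s → f s = 0)
    {K' M' : ℝ} (hK' : 0 ≤ K') (hΨlip : ∀ k₀ e k₀' e', ‖klfb_prop f' k₀ e - klfb_prop f' k₀' e'‖ ≤ K' * (|k₀ - k₀'| + |e - e'|))
    (hM' : ∀ k₀ e, ‖klfb_prop f' k₀ e‖ ≤ M')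
    (hMF : 0 ≤ MF) (hFlip : ∀ s s', ‖f s * f' s - f s' * f' s'‖ ≤ LF * |s - s'|) (hFbd : ∀ s, ‖f s * f' s‖ ≤ MF)
    (hLF : LF ≤ ℓ / klScale klE0 n ^ 2)
    (hlo : a' < μ - 4 * klScale klE0 n - κ₀) (hhi : μ + 4 * klScale klE0 n + κ₀ < b')
    (q₀ : ℝ) {β : ℝ} (hβ : klBetaMin ≤ β) (hn : n ≤ nScales β + 1) {M : ℕ}
    (hM : β * (4 * klScale klE0 n) / (2 * Real.pi) + 1 ≤ M) (L : ℕ) [NeZero L] :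
    ‖β⁻¹ • ∑ i : MatsubaraIdx M, ((L ^ 2 : ℕ) : ℝ)⁻¹ • ∑ k : TorusSite 2 L,
        a (latticeMomentum L k 0, latticeMomentum L k 1) *
          klfb_prop f (matsubaraFreq β M i) (eb (latticeMomentum L k 0, latticeMomentum L k 1)) *
            klfb_prop f' (matsubaraFreq β M i + q₀) (eb' (latticeMomentum L k 0, latticeMomentum L k 1))‖ ≤
      ((2 * π) ^ 2)⁻¹ *
          (∫ θ in Ioo (-π) π,
            (64 / Real.pi * MF *
                (Real.pi * Real.sqrt 2 / (B.Dtmin - κ₁) * (A₁ θ + A₀ * (2 / zm)) / (B.Dtmin - κ₁) +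
                  A₀ * (1 / (B.Dtmin - κ₁) ^ 2 + Real.pi * Real.sqrt 2 * (2 + κ₂) / (B.Dtmin - κ₁) ^ 3)) * klScale klE0 n +
              128 / Real.pi * MF * (Real.pi * Real.sqrt 2 / (B.Dtmin - κ₁) * δA θ) +
              393216 / Real.pi * (ℓ + 8 * MF) * (A₀ * (Real.pi * Real.sqrt 2 / (B.Dtmin - κ₁))) * ((Real.pi / β) / klScale klE0 n) +
              (64 / Real.pi * Mf * (A₀ * (Real.pi * Real.sqrt 2 / (B.Dtmin - κ₁))) * (K' * klScale klE0 n) * (|q₀| + δmax) +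
                48 / Real.pi * Mf * (A₀ * (Real.pi * Real.sqrt 2 / (B.Dtmin - κ₁))) * (K' * klScale klE0 n) * (|q₀| + δmax) *
                  ((Real.pi / β) / klScale klE0 n)))) +
        32 * klScale klE0 n *
            (La * (2 * Mf / klScale klE0 n) * M' +
              A₀ * ((9 * ℓf + 4 * Mf) / klScale klE0 n ^ 2 * Le) * M' +
              A₀ * (2 * Mf / klScale klE0 n) * (K' * Le')) / L := by
  have hΛ := klth_klScale_pos n
  have hr₁ : 0 < klScale klE0 n / 2 := by positivity
  have hr : 0 < 4 * klScale klE0 n := by positivity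
  have hA0' : 0 ≤ A₀ := (norm_nonneg _).trans (hA0 0)
  have hLa0 : 0 ≤ La := by
    have h := hLa (1, 0) (0, 0)
    have hd : (0 : ℝ) < dist ((1 : ℝ), (0 : ℝ)) ((0 : ℝ), (0 : ℝ)) := by rw [Prod.dist_eq]; simp
    exact nonneg_of_mul_nonneg_left ((norm_nonneg _).trans h) hd
  have hLe0 : 0 ≤ Le := by
    have h := hLe (1, 0) (0, 0)
    have hd : (0 : ℝ) < dist ((1 : ℝ), (0 : ℝ)) ((0 : ℝ), (0 : ℝ)) := by rw [Prod.dist_eq]; simp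
    exact nonneg_of_mul_nonneg_left ((abs_nonneg _).trans h) hd
  have hLe'0 : 0 ≤ Le' := by
    have h := hLe' (1, 0) (0, 0)
    have hd : (0 : ℝ) < dist ((1 : ℝ), (0 : ℝ)) ((0 : ℝ), (0 : ℝ)) := by rw [Prod.dist_eq]; simp
    exact nonneg_of_mul_nonneg_left ((abs_nonneg _).trans h) hd
  have hMf : 0 ≤ Mf := (norm_nonneg _).trans (hbd 0)
  have hM'0 : 0 ≤ M' := (norm_nonneg _).trans (hM' 0 0)
  have hℓf : 0 ≤ 9 * ℓf + 4 * Mf := by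
    have hLf0 : 0 ≤ Lf := by have := hlip 0 1; norm_num at this; linarith [norm_nonneg (f 0 - f 1)]
    have : 0 ≤ ℓf := by
      have h := hLf0.trans hLf; rwa [le_div_iff₀ (by positivity), zero_mul] at h
    positivity
  -- the planar weight `A = a·ψ`
  set A : ℝ × ℝ → ℂ := fun p => a p * (klfl_squareCut zm p : ℂ) with hAdef
  have hψbd : ∀ p, ‖(klfl_squareCut zm p : ℂ)‖ ≤ 1 := fun p => by
    rw [Complex.norm_real, Real.norm_of_nonneg (klfl_squareCut_mem zm p).1]; exact (klfl_squareCut_mem zm p).2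
  have hAc : Continuous A := ha.mul (Complex.continuous_ofReal.comp (klfl_continuous_squareCut zm))
  have hAsupp : ∀ p : ℝ × ℝ, A p ≠ 0 → |p.1| < π ∧ |p.2| < π := by
    intro p hp
    have hψ : klfl_squareCut zm p ≠ 0 := fun h0 => hp (by simp only [hAdef, h0, Complex.ofReal_zero, mul_zero])
    obtain ⟨h1, h2⟩ := klfl_abs_lt_of_squareCut_ne_zero hzm hψ
    exact ⟨by linarith, by linarith⟩
  have hAbd : ∀ p, ‖A p‖ ≤ A₀ := fun p => by
    simp only [hAdef]; rw [norm_mul]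
    calc ‖a p‖ * ‖(klfl_squareCut zm p : ℂ)‖ ≤ A₀ * 1 := mul_le_mul (hA0 p) (hψbd p) (norm_nonneg _) hA0'
      _ = A₀ := mul_one _
  have hArad : ∀ θ t t' : ℝ, 0 ≤ t → 0 ≤ t' → |klfb_band δ μ (t * Real.cos θ, t * Real.sin θ)| < 4 * klScale klE0 n →
      |klfb_band δ μ (t' * Real.cos θ, t' * Real.sin θ)| < 4 * klScale klE0 n →
      ‖A (t * Real.cos θ, t * Real.sin θ) - A (t' * Real.cos θ, t' * Real.sin θ)‖ ≤ (A₁ θ + A₀ * (2 / zm)) * |t - t'| + δA θ := by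
    intro θ t t' ht ht' hb hb'
    set x := (t * Real.cos θ, t * Real.sin θ) with hx
    set y := (t' * Real.cos θ, t' * Real.sin θ) with hy
    have hd : dist x y ≤ |t - t'| := klfl_dist_ray_le θ t t'
    have hA1θ := hA1' θ
    have hδAθ := hδA' θ
    have hsplit : A x - A y = (a x - a y) * (klfl_squareCut zm x : ℂ) + a y * ((klfl_squareCut zm x : ℂ) - (klfl_squareCut zm y : ℂ)) := by
      simp only [hAdef]; ring
    rw [hsplit]
    have h1 : ‖(a x - a y) * (klfl_squareCut zm x : ℂ)‖ ≤ (A₁ θ * |t - t'| + δA θ) * 1 := by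
      rw [norm_mul]
      exact mul_le_mul (haq θ t t' ht ht' hb hb') (hψbd x) (norm_nonneg _) (by positivity)
    have h2 : ‖a y * ((klfl_squareCut zm x : ℂ) - (klfl_squareCut zm y : ℂ))‖ ≤ A₀ * (2 / zm * |t - t'|) := by
      rw [norm_mul, ← Complex.ofReal_sub, Complex.norm_real, Real.norm_eq_abs]
      exact mul_le_mul (hA0 y) ((klfl_squareCut_lipschitz hzm x y).trans (mul_le_mul_of_nonneg_left hd (by positivity)))
        (abs_nonneg _) hA0'
    calc _ ≤ ‖(a x - a y) * (klfl_squareCut zm x : ℂ)‖ + ‖a y * ((klfl_squareCut zm x : ℂ) - (klfl_squareCut zm y : ℂ))‖ := norm_add_le _ _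
      _ ≤ (A₁ θ * |t - t'| + δA θ) * 1 + A₀ * (2 / zm * |t - t'|) := add_le_add h1 h2
      _ = (A₁ θ + A₀ * (2 / zm)) * |t - t'| + δA θ := by ring
  -- the planar bound
  have hA1s' : ∀ θ, 0 ≤ A₁ θ + A₀ * (2 / zm) := fun θ => by have := hA1' θ; positivity
  have hvol : volume (Ioo (-π) π) < ⊤ := by rw [Real.volume_Ioo]; exact ENNReal.ofReal_lt_top
  have hA1si : IntegrableOn (fun θ => A₁ θ + A₀ * (2 / zm)) (Ioo (-π) π) := hA1i.add (integrableOn_const (hs := hvol.ne))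
  have hB := klfs_planar_bubble_norm_le_of_lipschitzTCQ B hδ1 hδ hκ hκ₁ hAc hAsupp (A₀ := fun _ => A₀) (fun _ => hA0') hA1s' hδA'
    (integrableOn_const (hs := hvol.ne)) hA1si hδAi (fun θ t _ _ => hAbd _) hArad hκ₂ hD2 hlip hbd hin hout hK' hΨlip
    hMF hFlip hFbd hLF heb'c hδ0 he'δ hlo hhi q₀ hβ hn hM
  -- the periodic family and its properties
  set F : MatsubaraIdx M → ℝ × ℝ → ℂ := fun i p =>
    a p * klfb_prop f (matsubaraFreq β M i) (eb p) * klfb_prop f' (matsubaraFreq β M i + q₀) (eb' p) with hFdef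
  have hΦc : ∀ k₀, Continuous fun e => klfb_prop f k₀ e := fun k₀ => klfb_continuous_prop_snd hlip hbd hin hout hr₁ hr k₀
  have hΨc : ∀ k₀, Continuous fun e => klfb_prop f' k₀ e := fun k₀ => klfs_continuous_snd_of_lipschitz hΨlip k₀
  have hFc : ∀ i, Continuous (F i) := fun i => (ha.mul ((hΦc _).comp hebc)).mul ((hΨc _).comp heb'c)
  have hF1 : ∀ i x y, F i (x + 2 * π, y) = F i (x, y) := fun i x y => by simp only [hFdef, ha1, heb1, heb'1]
  have hF2 : ∀ i x y, F i (x, y + 2 * π) = F i (x, y) := fun i x y => by simp only [hFdef, ha2, heb2, heb'2]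
  set K : ℝ := La * (2 * Mf / klScale klE0 n) * M' +
    A₀ * ((9 * ℓf + 4 * Mf) / klScale klE0 n ^ 2 * Le) * M' +
    A₀ * (2 * Mf / klScale klE0 n) * (K' * Le') with hKdef
  have hK0 : 0 ≤ K := by rw [hKdef]; positivity
  have hFlip' : ∀ i (p q : ℝ × ℝ), ‖F i p - F i q‖ ≤ (K.toNNReal : ℝ) * dist p q := by
    intro i p q
    rw [Real.coe_toNNReal _ hK0]
    have hv : ∀ p q : ℝ × ℝ, ‖klfb_prop f (matsubaraFreq β M i) (eb p) - klfb_prop f (matsubaraFreq β M i) (eb q)‖ ≤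
        (9 * ℓf + 4 * Mf) / klScale klE0 n ^ 2 * Le * dist p q :=
      fun p q => (klfl_prop_lipschitz_snd hlip hbd hLf hin hout (matsubaraFreq β M i) (eb p) (eb q)).trans (by
        rw [mul_assoc]; exact mul_le_mul_of_nonneg_left (hLe p q) (by positivity))
    have hw : ∀ p q : ℝ × ℝ, ‖klfb_prop f' (matsubaraFreq β M i + q₀) (eb' p) - klfb_prop f' (matsubaraFreq β M i + q₀) (eb' q)‖ ≤
        K' * Le' * dist p q := by
      intro p q
      have h := hΨlip (matsubaraFreq β M i + q₀) (eb' p) (matsubaraFreq β M i + q₀) (eb' q)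
      rw [sub_self, abs_zero, zero_add] at h
      refine h.trans ?_
      rw [mul_assoc]; exact mul_le_mul_of_nonneg_left (hLe' p q) hK'
    exact klfl_lipschitz_triple (u := a) (v := fun p => klfb_prop f (matsubaraFreq β M i) (eb p))
      (w := fun p => klfb_prop f' (matsubaraFreq β M i + q₀) (eb' p))
      hA0 (fun p => klfl_prop_norm_le hbd hin (matsubaraFreq β M i) (eb p))
      (fun p => hM' (matsubaraFreq β M i + q₀) (eb' p)) hLa hv hw p q
  have hFh : ∀ i, ∀ p ∈ Icc (-π) π ×ˢ Icc (-π) π, F i p = klfb_integrand δ μ A f f' eb' (matsubaraFreq β M i) q₀ p :=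
    fun i p hp => klfl_integrand_eq_on_square hzm heb hzone hout (matsubaraFreq β M i) q₀ hp
  have hh0 : ∀ i, ∀ p ∉ Icc (-π) π ×ˢ Icc (-π) π, klfb_integrand δ μ A f f' eb' (matsubaraFreq β M i) q₀ p = 0 :=
    fun i p hp => klfl_integrand_eq_zero_off_square hzm (matsubaraFreq β M i) q₀ hp
  have hzero : ∀ i, 4 * klScale klE0 n ≤ |matsubaraFreq β M i| → ∀ p, F i p = 0 := by
    intro i hi p
    simp only [hFdef]
    rw [klfl_prop_eq_zero_of_le_abs_fst hout hi, mul_zero, zero_mul]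
  have h := klfl_matsubara_latticeAverage_norm_le_scale (F := F) (h := fun i => klfb_integrand δ μ A f f' eb' (matsubaraFreq β M i) q₀)
    hβ hn hFc hF1 hF2 hFlip' hFh hh0 hzero hB L
  rw [Real.coe_toNNReal _ hK0] at h
  exact h

end Lattice

/-! ## §2 The soft partner on the lattice, per-ray quasi-Lipschitz weight data -/

section Soft

variable {a' b' : ℝ} (B : BandBounds a' b') {δ : (Fin 2 → ℝ) → ℝ} (hδ1 : ContDiff ℝ 1 δ) {κ₀ κ₁ : ℝ}
  (hδ : ∀ k : Fin 2 → ℝ, (∀ i, |k i| ≤ π) → |δ k| ≤ κ₀)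
  (hκ : ∀ k : Fin 2 → ℝ, (∀ i, |k i| ≤ π) → ‖fderiv ℝ δ k‖ ≤ κ₁) (hκ₁ : κ₁ < B.Dtmin)

include B hδ1 hδ hκ hκ₁ in
/-- **THE FORWARD SLICE BUBBLE ON THE MODEL CARRIER WITH A SOFT PARTNER, per-ray quasi-Lipschitz weight data**: `klfl_lattice_soft_bubble_norm_leTC` with the radial modulus of the
weight asked per ray on the tube segment (`A₁(θ)|t − t'| + δ_A(θ)`), the planar bracket integrated over θ; conclusion at `K′ = (3ℓ' + 512M_f')/Λₙ²`, `M′ = 16M_f'/Λₙ`. -/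
theorem klfl_lattice_soft_bubble_norm_leTC_cells
    {κ₂ : ℝ} (hκ₂ : 0 ≤ κ₂)
    (hD2 : ∀ θ s t : ℝ, s ∈ Icc 0 (π / ‖dir θ‖) → t ∈ Icc 0 (π / ‖dir θ‖) →
      |fderiv ℝ δ (s • dir θ) (dir θ) - fderiv ℝ δ (t • dir θ) (dir θ)| ≤ κ₂ * |s - t|)
    {a : ℝ × ℝ → ℂ} (ha : Continuous a) (ha1 : ∀ x y, a (x + 2 * π, y) = a (x, y)) (ha2 : ∀ x y, a (x, y + 2 * π) = a (x, y))
    {A₀ La : ℝ} (hA0 : ∀ p, ‖a p‖ ≤ A₀) (hLa : ∀ p q, ‖a p - a q‖ ≤ La * dist p q)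
    {eb : ℝ × ℝ → ℝ} (hebc : Continuous eb) (heb1 : ∀ x y, eb (x + 2 * π, y) = eb (x, y)) (heb2 : ∀ x y, eb (x, y + 2 * π) = eb (x, y))
    {Le : ℝ} (hLe : ∀ p q, |eb p - eb q| ≤ Le * dist p q) {μ : ℝ} (heb : ∀ p ∈ Icc (-π) π ×ˢ Icc (-π) π, eb p = klfb_band δ μ p)
    {eb' : ℝ × ℝ → ℝ} (heb'c : Continuous eb') (heb'1 : ∀ x y, eb' (x + 2 * π, y) = eb' (x, y)) (heb'2 : ∀ x y, eb' (x, y + 2 * π) = eb' (x, y))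
    {Le' : ℝ} (hLe' : ∀ p q, |eb' p - eb' q| ≤ Le' * dist p q) {δmax : ℝ} (hδ0 : 0 ≤ δmax) {n : ℕ}
    (hδmax : δmax ≤ klScale klE0 n / 8) (hshift : ∀ p : ℝ × ℝ, |eb' p - eb p| ≤ δmax)
    {zm : ℝ} (hzm : 0 < zm)
    (hzone : ∀ p ∈ Icc (-π) π ×ˢ Icc (-π) π, |eb p| < 4 * klScale klE0 n → |p.1| ≤ π - 2 * zm ∧ |p.2| ≤ π - 2 * zm)
    {A₁ δA : ℝ → ℝ} (hA1' : ∀ θ, 0 ≤ A₁ θ) (hδA' : ∀ θ, 0 ≤ δA θ)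
    (hA1i : IntegrableOn A₁ (Ioo (-π) π)) (hδAi : IntegrableOn δA (Ioo (-π) π))
    (haq : ∀ θ t t' : ℝ, 0 ≤ t → 0 ≤ t' → |klfb_band δ μ (t * Real.cos θ, t * Real.sin θ)| < 4 * klScale klE0 n →
      |klfb_band δ μ (t' * Real.cos θ, t' * Real.sin θ)| < 4 * klScale klE0 n →
      ‖a (t * Real.cos θ, t * Real.sin θ) - a (t' * Real.cos θ, t' * Real.sin θ)‖ ≤ A₁ θ * |t - t'| + δA θ)
    {f f' : ℝ → ℂ} {Lf Mf ℓf Lf' Mf' ℓ' LF MF ℓ : ℝ}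
    (hlip : ∀ s s', ‖f s - f s'‖ ≤ Lf * |s - s'|) (hbd : ∀ s, ‖f s‖ ≤ Mf) (hLf : Lf ≤ ℓf / klScale klE0 n ^ 2)
    (hin : ∀ s, s ≤ (klScale klE0 n / 2) ^ 2 → f s = 0) (hout : ∀ s, (4 * klScale klE0 n) ^ 2 ≤ s → f s = 0)
    (hlip' : ∀ s s', ‖f' s - f' s'‖ ≤ Lf' * |s - s'|) (hbd' : ∀ s, ‖f' s‖ ≤ Mf') (hLf' : Lf' ≤ ℓ' / klScale klE0 n ^ 2)
    (hMF : 0 ≤ MF) (hFlip : ∀ s s', ‖f s * f' s - f s' * f' s'‖ ≤ LF * |s - s'|) (hFbd : ∀ s, ‖f s * f' s‖ ≤ MF)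
    (hLF : LF ≤ ℓ / klScale klE0 n ^ 2)
    (hlo : a' < μ - 4 * klScale klE0 n - κ₀) (hhi : μ + 4 * klScale klE0 n + κ₀ < b')
    {q₀ : ℝ} (hq₀ : |q₀| ≤ klScale klE0 n / 8) {β : ℝ} (hβ : klBetaMin ≤ β) (hn : n ≤ nScales β + 1) {M : ℕ}
    (hM : β * (4 * klScale klE0 n) / (2 * Real.pi) + 1 ≤ M) (L : ℕ) [NeZero L] :
    ‖β⁻¹ • ∑ i : MatsubaraIdx M, ((L ^ 2 : ℕ) : ℝ)⁻¹ • ∑ k : TorusSite 2 L,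
        a (latticeMomentum L k 0, latticeMomentum L k 1) *
          klfb_prop f (matsubaraFreq β M i) (eb (latticeMomentum L k 0, latticeMomentum L k 1)) *
            klfb_prop f' (matsubaraFreq β M i + q₀) (eb' (latticeMomentum L k 0, latticeMomentum L k 1))‖ ≤
      ((2 * π) ^ 2)⁻¹ *
          (∫ θ in Ioo (-π) π,
            (64 / Real.pi * MF *
                (Real.pi * Real.sqrt 2 / (B.Dtmin - κ₁) * (A₁ θ + A₀ * (2 / zm)) / (B.Dtmin - κ₁) +
                  A₀ * (1 / (B.Dtmin - κ₁) ^ 2 + Real.pi * Real.sqrt 2 * (2 + κ₂) / (B.Dtmin - κ₁) ^ 3)) * klScale klE0 n +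
              128 / Real.pi * MF * (Real.pi * Real.sqrt 2 / (B.Dtmin - κ₁) * δA θ) +
              393216 / Real.pi * (ℓ + 8 * MF) * (A₀ * (Real.pi * Real.sqrt 2 / (B.Dtmin - κ₁))) * ((Real.pi / β) / klScale klE0 n) +
              (64 / Real.pi * Mf * (A₀ * (Real.pi * Real.sqrt 2 / (B.Dtmin - κ₁))) *
                ((3 * ℓ' + 512 * Mf') / klScale klE0 n ^ 2 * klScale klE0 n) * (|q₀| + δmax) +
                48 / Real.pi * Mf * (A₀ * (Real.pi * Real.sqrt 2 / (B.Dtmin - κ₁))) *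
                ((3 * ℓ' + 512 * Mf') / klScale klE0 n ^ 2 * klScale klE0 n) * (|q₀| + δmax) * ((Real.pi / β) / klScale klE0 n)))) +
        32 * klScale klE0 n *
            (La * (2 * Mf / klScale klE0 n) * (16 * Mf' / klScale klE0 n) +
              A₀ * ((9 * ℓf + 4 * Mf) / klScale klE0 n ^ 2 * Le) * (16 * Mf' / klScale klE0 n) +
              A₀ * (2 * Mf / klScale klE0 n) * ((3 * ℓ' + 512 * Mf') / klScale klE0 n ^ 2 * Le')) / L := by
  have hΛ := klth_klScale_pos n
  have hMf' : 0 ≤ Mf' := (norm_nonneg _).trans (hbd' 0)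
  have hLf'0 : 0 ≤ Lf' := by have := hlip' 0 1; norm_num at this; linarith [norm_nonneg (f' 0 - f' 1)]
  have hℓ' : 0 ≤ ℓ' := by have h := hLf'0.trans hLf'; rwa [le_div_iff₀ (by positivity), zero_mul] at h
  have he'δ : ∀ p : ℝ × ℝ, |p.1| < π → |p.2| < π → |eb' p - klfb_band δ μ p| ≤ δmax := by
    intro p h1 h2
    rw [← heb p ⟨⟨(abs_lt.mp h1).1.le, (abs_lt.mp h1).2.le⟩, ⟨(abs_lt.mp h2).1.le, (abs_lt.mp h2).2.le⟩⟩]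
    exact hshift p
  have hcut : ∀ (i : MatsubaraIdx M) (k : TorusSite 2 L),
      a (latticeMomentum L k 0, latticeMomentum L k 1) *
          klfb_prop f (matsubaraFreq β M i) (eb (latticeMomentum L k 0, latticeMomentum L k 1)) *
            klfb_prop f' (matsubaraFreq β M i + q₀) (eb' (latticeMomentum L k 0, latticeMomentum L k 1)) =
        a (latticeMomentum L k 0, latticeMomentum L k 1) *
          klfb_prop f (matsubaraFreq β M i) (eb (latticeMomentum L k 0, latticeMomentum L k 1)) *
            klfb_prop (fun s => f' s * (klfp_cut (klScale klE0 n) s : ℂ)) (matsubaraFreq β M i + q₀)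
              (eb' (latticeMomentum L k 0, latticeMomentum L k 1)) :=
    fun i k => klfl_summand_cut_eq hin hq₀ ((hshift _).trans hδmax)
  simp_rw [hcut]
  have hK' : 0 ≤ (3 * ℓ' + 512 * Mf') / klScale klE0 n ^ 2 := by positivity
  have hFlip'' : ∀ s s', ‖f s * (f' s * (klfp_cut (klScale klE0 n) s : ℂ)) - f s' * (f' s' * (klfp_cut (klScale klE0 n) s' : ℂ))‖ ≤
      LF * |s - s'| := fun s s' => by rw [klfp_mul_cutWeight_eq hin s, klfp_mul_cutWeight_eq hin s']; exact hFlip s s'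
  have hFbd'' : ∀ s, ‖f s * (f' s * (klfp_cut (klScale klE0 n) s : ℂ))‖ ≤ MF := fun s => by
    rw [klfp_mul_cutWeight_eq hin s]; exact hFbd s
  exact klfl_lattice_forward_bubble_norm_le_of_lipschitzTC_cells B hδ1 hδ hκ hκ₁ hκ₂ hD2 ha ha1 ha2 hA0 hLa hebc heb1 heb2 hLe heb heb'c heb'1 heb'2
    hLe' hδ0 he'δ hzm hzone hA1' hδA' hA1i hδAi haq hlip hbd hLf hin hout hK' (klfp_prop_cutWeight_lipschitz_path hlip' hbd' hLf')
    (klfl_prop_cutWeight_norm_le hbd') hMF hFlip'' hFbd'' hLF hlo hhi q₀ hβ hn hM L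

end Soft

end Summit.HubbardSuperconductivity.HubbardSuperconductivity.Theorems.KLRegimeSplit

end
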